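import Mathlib.Analysis.Calculus.ContDiff.Operations
import Mathlib.Analysis.Calculus.MeanValue
import Mathlib.Analysis.Normed.Field.Lemmas
import Literature.Analysis.FunctionSpaces.HolderOnSetToolkit
import HarnessLib

/-!
# Difference quotients of `C^{k,α}` functions on concentric balls

Topic `Literature/Analysis/Calculus`. The elementary calculus of the difference quotients

  `Δₕᵉ f (y) := h⁻¹ • (f (y + h • e) - f y)`

of a map `f : E → F` between real normed spaces, on concentric balls `B(x₀, R') ⊂ B(x₀, R)`
with `‖h • e‖ ≤ R - R'` (so that the whole segment `[y, y + h e]` of a point `y ∈ B(x₀, R')`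
stays in `B(x₀, R)`), as used in the difference-quotient method of elliptic regularity theory
(Gilbarg–Trudinger 2001, §17.4, proof of Lemma 17.16; Nirenberg's method):

* `contDiffOn_diffQuot`, `iteratedFDeriv_diffQuot`, `fderiv_diffQuot` — `Δₕ f` is as smooth
  as `f`, and its (iterated) derivatives are the difference quotients of those of `f`;
* `norm_diffQuot_le` — `‖Δₕ f‖ ≤ B ‖e‖` on the small ball if `‖Df‖ ≤ B` on the big one
  (mean value inequality), UNIFORMLY in `h`;
* `holderOnWith_diffQuot` — `Δₕ f` is `α`-Hölder on the small ball with constant `C ‖e‖`,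
  UNIFORMLY in `h`, if `Df` is `(C, α)`-Hölder on the big one (mean value inequality applied to
  `t ↦ f(y + t h e) - f(y' + t h e)`);
* `tendsto_diffQuot` — `Δ_{hₙ} f (y) → Df(y) e` along any sequence `hₙ → 0`, `hₙ ≠ 0`;
* `norm_fderiv_fderiv_le_norm_iteratedFDeriv_two`,
  `holderOnWith_fderiv_fderiv_of_iteratedFDeriv_two`, `holderOnWith_fderiv_of_iteratedFDeriv_one`
  — passing sup / Hölder bounds stated for Mathlib's `iteratedFDeriv ℝ 1 f`, `iteratedFDeriv ℝ 2 f`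
  (the form of the tree's Schauder files) to `fderiv ℝ f`, `fderiv ℝ (fderiv ℝ f)` (the form in
  which the difference quotients of `Df` are difference quotients).

A first section complements `Literature/Analysis/FunctionSpaces/HolderOnSetToolkit.lean` with the
vector-valued Hölder-on-a-set algebra these arguments need (scalar multiples, differences,
shifts `y ↦ f (y + z)` between concentric balls, and the "product rule"
`y ↦ A(y) (ζ(y))` for a Hölder family of continuous linear maps applied to a Hölder map), as
`holderOnWith_const_smul`, `holderOnWith_sub`, `holderOnWith_comp_add_ball`,
`holderOnWith_clm_apply_of_bound`, ….

No definition is introduced (the quotient is written out in every statement). Everything is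
proved; no named facts. Not here: higher-order difference quotients, `Lᵖ` difference quotients
(Gilbarg–Trudinger §7.11), and anything about equations.

## References

* D. Gilbarg, N. S. Trudinger, *Elliptic Partial Differential Equations of Second Order*,
  Classics in Mathematics, Springer 2001, §17.4 (proof of Lemma 17.16) and §6.4.
  [GilbargTrudinger2001]
-/

noncomputable section

open Set Function Filter Metric
open scoped Topology NNReal ENNReal

namespace Literature.Analysis.Calculus

open Literature.Analysis.FunctionSpaces
open Literature.Analysis.PDE (holderOnWith_of_dist_le_rpow)

/-! ### Complements on Hölder maps on a set (vector-valued) -/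

section HolderAlgebra

variable {X : Type*} [PseudoMetricSpace X] {s : Set X} {r : ℝ≥0}
  {F : Type*} [NormedAddCommGroup F]

/-- **Scalar multiple of a vector-valued Hölder map on a set**: the constant is multiplied by
`‖a‖₊`. [folklore] -/
theorem holderOnWith_const_smul [NormedSpace ℝ F] {f : X → F} {C : ℝ≥0}
    (hf : HolderOnWith C r f s) (a : ℝ) : HolderOnWith (‖a‖₊ * C) r (fun x => a • f x) s := by
  intro x hx y hy
  calc edist (a • f x) (a • f y) = (‖a‖₊ : ℝ≥0∞) * edist (f x) (f y) := by
        rw [edist_smul₀, ENNReal.smul_def, smul_eq_mul]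
    _ ≤ (‖a‖₊ : ℝ≥0∞) * (C * edist x y ^ (r : ℝ)) := by gcongr; exact hf x hx y hy
    _ = ((‖a‖₊ * C : ℝ≥0) : ℝ≥0∞) * edist x y ^ (r : ℝ) := by rw [ENNReal.coe_mul, mul_assoc]

/-- **Negative of a Hölder map on a set** (same constant). [folklore] -/
theorem holderOnWith_neg {f : X → F} {C : ℝ≥0} (hf : HolderOnWith C r f s) :
    HolderOnWith C r (fun x => -f x) s := by
  intro x hx y hy
  rw [edist_neg_neg]
  exact hf x hx y hy

/-- **Difference of Hölder maps on a set**: the constants add. [folklore] -/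
theorem holderOnWith_sub {f g : X → F} {Cf Cg : ℝ≥0} (hf : HolderOnWith Cf r f s)
    (hg : HolderOnWith Cg r g s) : HolderOnWith (Cf + Cg) r (fun x => f x - g x) s := by
  simpa only [sub_eq_add_neg] using hf.add' (holderOnWith_neg hg)

/-- **A Hölder family of continuous linear maps applied to a Hölder map**: if `‖A x‖ ≤ M`, `‖ζ x‖ ≤ N` on `s`, `A` is `(K_A, r)`-Hölder and
`ζ` is `(K_ζ, r)`-Hölder on `s`, then `x ↦ A x (ζ x)` is `(M K_ζ + N K_A, r)`-Hölder on `s`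
(`A x (ζ x) - A y (ζ y) = A x (ζ x - ζ y) + (A x - A y) (ζ y)`). [folklore] -/
theorem holderOnWith_clm_apply_of_bound {W G : Type*} [NormedAddCommGroup W] [NormedSpace ℝ W]
    [NormedAddCommGroup G] [NormedSpace ℝ G] {A : X → W →L[ℝ] G} {ζ : X → W}
    {KA Kζ M N : ℝ≥0} (hA : HolderOnWith KA r A s) (hζ : HolderOnWith Kζ r ζ s)
    (hM : ∀ x ∈ s, ‖A x‖ ≤ M) (hN : ∀ x ∈ s, ‖ζ x‖ ≤ N) :
    HolderOnWith (M * Kζ + N * KA) r (fun x => A x (ζ x)) s := by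
  refine holderOnWith_of_dist_le_rpow fun x hx y hy => ?_
  have hAd : dist (A x) (A y) ≤ KA * dist x y ^ (r : ℝ) := hA.dist_le hx hy
  have hζd : dist (ζ x) (ζ y) ≤ Kζ * dist x y ^ (r : ℝ) := hζ.dist_le hx hy
  rw [dist_eq_norm] at hAd hζd ⊢
  calc ‖A x (ζ x) - A y (ζ y)‖ = ‖A x (ζ x - ζ y) + (A x - A y) (ζ y)‖ := by
        congr 1
        rw [map_sub, sub_apply]
        abel
    _ ≤ ‖A x (ζ x - ζ y)‖ + ‖(A x - A y) (ζ y)‖ := norm_add_le _ _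
    _ ≤ ‖A x‖ * ‖ζ x - ζ y‖ + ‖A x - A y‖ * ‖ζ y‖ :=
        add_le_add ((A x).le_opNorm _) ((A x - A y).le_opNorm _)
    _ ≤ M * (Kζ * dist x y ^ (r : ℝ)) + KA * dist x y ^ (r : ℝ) * N := by
        gcongr
        · exact hM x hx
        · exact hN y hy
    _ = ↑(M * Kζ + N * KA) * dist x y ^ (r : ℝ) := by push_cast; ring

/-- **A Hölder family of continuous linear maps evaluated at a fixed vector**: `x ↦ A x u` is `(‖u‖₊ K_A, r)`-Hölder. [folklore] -/
theorem holderOnWith_clm_apply_const {W G : Type*} [NormedAddCommGroup W] [NormedSpace ℝ W]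
    [NormedAddCommGroup G] [NormedSpace ℝ G] {A : X → W →L[ℝ] G} {KA : ℝ≥0}
    (hA : HolderOnWith KA r A s) (u : W) : HolderOnWith (‖u‖₊ * KA) r (fun x => A x u) s := by
  refine holderOnWith_of_dist_le_rpow fun x hx y hy => ?_
  have hAd : dist (A x) (A y) ≤ KA * dist x y ^ (r : ℝ) := hA.dist_le hx hy
  rw [dist_eq_norm] at hAd ⊢
  calc ‖A x u - A y u‖ = ‖(A x - A y) u‖ := by rw [sub_apply]
    _ ≤ ‖A x - A y‖ * ‖u‖ := (A x - A y).le_opNorm u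
    _ ≤ KA * dist x y ^ (r : ℝ) * ‖u‖ := by gcongr
    _ = ↑(‖u‖₊ * KA) * dist x y ^ (r : ℝ) := by push_cast; ring

/-- **A fixed continuous linear map after a Hölder map**: `x ↦ L (ζ x)` is `(‖L‖₊ K, r)`-Hölder. [folklore] -/
theorem holderOnWith_const_clm_comp {W G : Type*} [NormedAddCommGroup W] [NormedSpace ℝ W]
    [NormedAddCommGroup G] [NormedSpace ℝ G] (L : W →L[ℝ] G) {ζ : X → W} {K : ℝ≥0}
    (hζ : HolderOnWith K r ζ s) : HolderOnWith (‖L‖₊ * K) r (fun x => L (ζ x)) s := by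
  refine holderOnWith_of_dist_le_rpow fun x hx y hy => ?_
  have hζd : dist (ζ x) (ζ y) ≤ K * dist x y ^ (r : ℝ) := hζ.dist_le hx hy
  rw [dist_eq_norm] at hζd ⊢
  calc ‖L (ζ x) - L (ζ y)‖ = ‖L (ζ x - ζ y)‖ := by rw [map_sub]
    _ ≤ ‖L‖ * ‖ζ x - ζ y‖ := L.le_opNorm _
    _ ≤ ‖L‖ * (K * dist x y ^ (r : ℝ)) := by gcongr
    _ = ↑(‖L‖₊ * K) * dist x y ^ (r : ℝ) := by push_cast; ring

end HolderAlgebra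

/-! ### Shifts between concentric balls -/

section Shift

variable {E : Type*} [NormedAddCommGroup E]

/-- A point of `B(x₀, R')` shifted by a vector of norm `≤ R - R'` lies in `B(x₀, R)`. [folklore] -/
theorem add_mem_ball_of_norm_le {x₀ y z : E} {R R' : ℝ} (hy : y ∈ ball x₀ R')
    (hz : ‖z‖ ≤ R - R') : y + z ∈ ball x₀ R := by
  rw [mem_ball, dist_eq_norm] at hy ⊢
  calc ‖y + z - x₀‖ = ‖(y - x₀) + z‖ := by abel_nf
    _ ≤ ‖y - x₀‖ + ‖z‖ := norm_add_le _ _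
    _ < R' + (R - R') := add_lt_add_of_lt_of_le hy hz
    _ = R := by ring

/-- The points `y + t • z`, `t ∈ [0, 1]`, of the segment from `y ∈ B(x₀, R')` in a direction of
norm `≤ R - R'` lie in `B(x₀, R)`. [folklore] -/
theorem add_smul_mem_ball_of_norm_le [NormedSpace ℝ E] {x₀ y z : E} {R R' : ℝ}
    (hy : y ∈ ball x₀ R') (hz : ‖z‖ ≤ R - R') {t : ℝ} (ht : t ∈ Icc (0 : ℝ) 1) :
    y + t • z ∈ ball x₀ R := by
  refine add_mem_ball_of_norm_le hy ((norm_smul_le t z).trans ?_)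
  calc ‖t‖ * ‖z‖ ≤ 1 * ‖z‖ := by
        gcongr
        rw [Real.norm_eq_abs, abs_of_nonneg ht.1]
        exact ht.2
    _ ≤ R - R' := by rw [one_mul]; exact hz

/-- **Shifting a Hölder map between concentric balls**: if `f` is `(C, r)`-Hölder on `B(x₀, R)`
and `‖z‖ ≤ R - R'`, then `y ↦ f (y + z)` is `(C, r)`-Hölder on `B(x₀, R')` (the shift is an
isometry into the big ball). [folklore] -/
theorem holderOnWith_comp_add_ball {Y : Type*} [PseudoEMetricSpace Y] {f : E → Y} {x₀ z : E}
    {R R' : ℝ} {C r : ℝ≥0} (hf : HolderOnWith C r f (ball x₀ R)) (hz : ‖z‖ ≤ R - R') :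
    HolderOnWith C r (fun y => f (y + z)) (ball x₀ R') := by
  intro x hx y hy
  have h := hf (x + z) (add_mem_ball_of_norm_le hx hz) (y + z) (add_mem_ball_of_norm_le hy hz)
  rwa [edist_add_right] at h

/-- A bound on the big ball gives a bound for the shifted map on the small ball. [folklore] -/
theorem forall_comp_add_ball {x₀ z : E} {R R' : ℝ} {p : E → Prop}
    (hp : ∀ y ∈ ball x₀ R, p y) (hz : ‖z‖ ≤ R - R') : ∀ y ∈ ball x₀ R', p (y + z) :=
  fun _ hy => hp _ (add_mem_ball_of_norm_le hy hz)

end Shift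

/-! ### Operator norms of `Df`, `D(Df)` versus `D¹f`, `D²f` -/

section Curry

variable {E F : Type*} [NormedAddCommGroup E] [NormedSpace ℝ E] [NormedAddCommGroup F]
  [NormedSpace ℝ F]

/-- A continuous linear map that is a `1`-linear map evaluated on constant tuples has the smaller
operator norm: `A u = D (u)` for all `u` gives `‖A‖ ≤ ‖D‖`. [folklore] -/
theorem opNorm_le_of_apply_eq_one {A : E →L[ℝ] F} {D : E [×1]→L[ℝ] F}
    (h : ∀ u, A u = D (fun _ => u)) : ‖A‖ ≤ ‖D‖ := by
  refine ContinuousLinearMap.opNorm_le_bound _ (norm_nonneg _) fun u => ?_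
  rw [h u]
  refine (D.le_opNorm _).trans_eq ?_
  rw [Fin.prod_univ_one]

/-- A continuous bilinear map that is a `2`-linear map on pairs has the smaller operator norm:
`A u w = D (u, w)` for all `u, w` gives `‖A‖ ≤ ‖D‖`. [folklore] -/
theorem opNorm_le_of_apply_eq_two {A : E →L[ℝ] E →L[ℝ] F} {D : E [×2]→L[ℝ] F}
    (h : ∀ u w, A u w = D ![u, w]) : ‖A‖ ≤ ‖D‖ := by
  refine ContinuousLinearMap.opNorm_le_bound _ (norm_nonneg _) fun u => ?_
  refine ContinuousLinearMap.opNorm_le_bound _ (by positivity) fun w => ?_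
  rw [h u w]
  refine (D.le_opNorm _).trans_eq ?_
  rw [Fin.prod_univ_two]
  simp only [Matrix.cons_val_zero, Matrix.cons_val_one, mul_assoc]

/-- `‖D(Df)(x)‖ ≤ ‖D²f(x)‖` (`D²f(x)(u, w) = D(Df)(x) u w`, Mathlib's `iteratedFDeriv_two_apply`).
[folklore] -/
theorem norm_fderiv_fderiv_le_norm_iteratedFDeriv_two (f : E → F) (x : E) :
    ‖fderiv ℝ (fderiv ℝ f) x‖ ≤ ‖iteratedFDeriv ℝ 2 f x‖ :=
  opNorm_le_of_apply_eq_two fun u w => by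
    rw [iteratedFDeriv_two_apply]
    rfl

/-- **Hölder bounds of `D¹f` give Hölder bounds of `Df`** (same constant): the two differ by a
linear isometry. [folklore] -/
theorem holderOnWith_fderiv_of_iteratedFDeriv_one {f : E → F} {s : Set E} {C r : ℝ≥0}
    (hC : HolderOnWith C r (iteratedFDeriv ℝ 1 f) s) : HolderOnWith C r (fderiv ℝ f) s :=
  fun x hx y hy => by
    refine le_trans ?_ (hC x hx y hy)
    rw [edist_dist, edist_dist, dist_eq_norm, dist_eq_norm]
    exact ENNReal.ofReal_le_ofReal (opNorm_le_of_apply_eq_one fun u => by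
      simp only [sub_apply, iteratedFDeriv_one_apply])

/-- **Hölder bounds of `D²f` give Hölder bounds of `D(Df)`** (same constant). [folklore] -/
theorem holderOnWith_fderiv_fderiv_of_iteratedFDeriv_two {f : E → F} {s : Set E} {C r : ℝ≥0}
    (hC : HolderOnWith C r (iteratedFDeriv ℝ 2 f) s) :
    HolderOnWith C r (fderiv ℝ (fderiv ℝ f)) s :=
  fun x hx y hy => by
    refine le_trans ?_ (hC x hx y hy)
    rw [edist_dist, edist_dist, dist_eq_norm, dist_eq_norm]
    exact ENNReal.ofReal_le_ofReal (opNorm_le_of_apply_eq_two fun u w => by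
      simp only [sub_apply, iteratedFDeriv_two_apply,
        Matrix.cons_val_zero, Matrix.cons_val_one])

end Curry

/-! ### Difference quotients -/

section DiffQuot

variable {E F : Type*} [NormedAddCommGroup E] [NormedSpace ℝ E] [NormedAddCommGroup F]
  [NormedSpace ℝ F]

/-- **Translates are as smooth**: if `f ∈ Cⁿ(B(x₀, R))` and `‖z‖ ≤ R - R'` then
`y ↦ f (y + z)` is `Cⁿ` on `B(x₀, R')`. [folklore] -/
theorem contDiffOn_comp_add_ball {n : WithTop ℕ∞} {f : E → F} {x₀ z : E} {R R' : ℝ}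
    (hf : ContDiffOn ℝ n f (ball x₀ R)) (hz : ‖z‖ ≤ R - R') :
    ContDiffOn ℝ n (fun y => f (y + z)) (ball x₀ R') :=
  hf.comp (contDiff_id.add contDiff_const).contDiffOn fun _ hy => add_mem_ball_of_norm_le hy hz

/-- **Difference quotients are as smooth**: if `f ∈ Cⁿ(B(x₀, R))` and `‖h • e‖ ≤ R - R'` then
`Δₕᵉ f = h⁻¹ • (f (· + h • e) - f)` is `Cⁿ` on `B(x₀, R')`. [folklore] -/
theorem contDiffOn_diffQuot {n : WithTop ℕ∞} {f : E → F} {x₀ e : E} {R R' h : ℝ}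
    (hf : ContDiffOn ℝ n f (ball x₀ R)) (hhe : ‖h • e‖ ≤ R - R') :
    ContDiffOn ℝ n (fun y => h⁻¹ • (f (y + h • e) - f y)) (ball x₀ R') :=
  contDiffOn_const.smul ((contDiffOn_comp_add_ball hf hhe).sub
    (hf.mono (ball_subset_ball (sub_nonneg.1 ((norm_nonneg _).trans hhe)))))

/-- **Iterated derivatives of a difference quotient** are the difference quotients of the
iterated derivatives: `Dⁿ(Δₕᵉ f)(y) = h⁻¹ • (Dⁿf(y + h e) - Dⁿf(y))` whenever `f` is `Cⁿ` at
`y` and at `y + h e` (linearity and translation invariance of `iteratedFDeriv`). [folklore] -/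
theorem iteratedFDeriv_diffQuot {n : ℕ} {f : E → F} {y e : E} {h : ℝ}
    (hy : ContDiffAt ℝ n f y) (hye : ContDiffAt ℝ n f (y + h • e)) :
    iteratedFDeriv ℝ n (fun y => h⁻¹ • (f (y + h • e) - f y)) y =
      h⁻¹ • (iteratedFDeriv ℝ n f (y + h • e) - iteratedFDeriv ℝ n f y) := by
  have htr : ContDiffAt ℝ n (fun y => f (y + h • e)) y :=
    hye.comp y (contDiffAt_id.add contDiffAt_const)
  rw [iteratedFDeriv_const_smul_apply' (a := h⁻¹) (htr.sub hy),
    fun_iteratedFDeriv_sub_apply htr hy, iteratedFDeriv_comp_add_right]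

/-- **The derivative of a difference quotient** is the difference quotient of the derivative:
`D(Δₕᵉ f)(y) = h⁻¹ • (Df(y + h e) - Df(y))` whenever `f` is differentiable at `y` and at
`y + h e`. [folklore] -/
theorem fderiv_diffQuot {f : E → F} {y e : E} {h : ℝ} (hy : DifferentiableAt ℝ f y)
    (hye : DifferentiableAt ℝ f (y + h • e)) :
    fderiv ℝ (fun y => h⁻¹ • (f (y + h • e) - f y)) y =
      h⁻¹ • (fderiv ℝ f (y + h • e) - fderiv ℝ f y) := by
  have h1 : HasFDerivAt (fun y => f (y + h • e)) (fderiv ℝ f (y + h • e)) y := by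
    have h0 := hye.hasFDerivAt.comp y ((hasFDerivAt_id y).add_const (h • e))
    rw [ContinuousLinearMap.comp_id] at h0
    exact h0
  exact ((h1.sub hy.hasFDerivAt).const_smul h⁻¹).fderiv

/-- On concentric balls: `D(Δₕᵉ f)(y) = h⁻¹ • (Df(y + h e) - Df(y))` for `y ∈ B(x₀, R')` when
`f` is differentiable on `B(x₀, R)` and `‖h • e‖ ≤ R - R'`. [folklore] -/
theorem fderiv_diffQuot_of_mem_ball {f : E → F} {x₀ e : E} {R R' h : ℝ}
    (hf : DifferentiableOn ℝ f (ball x₀ R)) (hhe : ‖h • e‖ ≤ R - R') {y : E}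
    (hy : y ∈ ball x₀ R') :
    fderiv ℝ (fun y => h⁻¹ • (f (y + h • e) - f y)) y =
      h⁻¹ • (fderiv ℝ f (y + h • e) - fderiv ℝ f y) :=
  fderiv_diffQuot (hf.differentiableAt (isOpen_ball.mem_nhds
      (ball_subset_ball (sub_nonneg.1 ((norm_nonneg _).trans hhe)) hy)))
    (hf.differentiableAt (isOpen_ball.mem_nhds (add_mem_ball_of_norm_le hy hhe)))

/-- **Mean value inequality for a shift**: if `f` is differentiable on `B(x₀, R)` with
`‖Df‖ ≤ B` there, `y ∈ B(x₀, R')` and `‖z‖ ≤ R - R'`, then `‖f (y + z) - f y‖ ≤ B ‖z‖`.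
[folklore] -/
theorem norm_comp_add_sub_le {f : E → F} {x₀ z : E} {R R' B : ℝ}
    (hf : DifferentiableOn ℝ f (ball x₀ R)) (hB : ∀ x ∈ ball x₀ R, ‖fderiv ℝ f x‖ ≤ B)
    (hz : ‖z‖ ≤ R - R') {y : E} (hy : y ∈ ball x₀ R') : ‖f (y + z) - f y‖ ≤ B * ‖z‖ := by
  have hyR : y ∈ ball x₀ R := ball_subset_ball (sub_nonneg.1 ((norm_nonneg _).trans hz)) hy
  have hd : ∀ w ∈ ball x₀ R, DifferentiableAt ℝ f w := fun w hw =>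
    hf.differentiableAt (isOpen_ball.mem_nhds hw)
  have hmvt : ‖f (y + z) - f y‖ ≤ B * ‖y + z - y‖ :=
    (convex_ball x₀ R).norm_image_sub_le_of_norm_fderiv_le hd hB hyR (add_mem_ball_of_norm_le hy hz)
  rwa [add_sub_cancel_left] at hmvt

/-- **Sup bound of difference quotients, uniformly in `h`**: if `f` is differentiable on
`B(x₀, R)` with `‖Df‖ ≤ B` there and `‖h • e‖ ≤ R - R'`, then `‖Δₕᵉ f (y)‖ ≤ B ‖e‖` for
`y ∈ B(x₀, R')` (mean value inequality on the convex ball). [folklore] -/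
theorem norm_diffQuot_le {f : E → F} {x₀ e : E} {R R' h B : ℝ}
    (hf : DifferentiableOn ℝ f (ball x₀ R)) (hB : ∀ x ∈ ball x₀ R, ‖fderiv ℝ f x‖ ≤ B)
    (hhe : ‖h • e‖ ≤ R - R') {y : E} (hy : y ∈ ball x₀ R') :
    ‖h⁻¹ • (f (y + h • e) - f y)‖ ≤ B * ‖e‖ := by
  have hyR : y ∈ ball x₀ R := ball_subset_ball (sub_nonneg.1 ((norm_nonneg _).trans hhe)) hy
  have hB0 : 0 ≤ B := (norm_nonneg _).trans (hB y hyR)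
  rcases eq_or_ne h 0 with rfl | hh
  · simp only [inv_zero, zero_smul, norm_zero]; positivity
  have hd : ∀ z ∈ ball x₀ R, DifferentiableAt ℝ f z := fun z hz =>
    hf.differentiableAt (isOpen_ball.mem_nhds hz)
  have hmvt : ‖f (y + h • e) - f y‖ ≤ B * ‖y + h • e - y‖ :=
    (convex_ball x₀ R).norm_image_sub_le_of_norm_fderiv_le hd hB hyR
      (add_mem_ball_of_norm_le hy hhe)
  rw [add_sub_cancel_left, norm_smul] at hmvt
  rw [norm_smul, norm_inv]
  calc ‖h‖⁻¹ * ‖f (y + h • e) - f y‖ ≤ ‖h‖⁻¹ * (B * (‖h‖ * ‖e‖)) := by gcongr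
    _ = B * ‖e‖ := by rw [mul_left_comm, inv_mul_cancel_left₀ (norm_ne_zero_iff.2 hh)]

/-- **Hölder bound of difference quotients, uniformly in `h`**: if `f` is differentiable on
`B(x₀, R)`, `Df` is `(C, α)`-Hölder there and `‖h • e‖ ≤ R - R'`, then `Δₕᵉ f` is
`(C ‖e‖, α)`-Hölder on `B(x₀, R')`.  Proof: for `y, y' ∈ B(x₀, R')` apply the mean value
inequality to `t ↦ f(y + t h e) - f(y' + t h e)` on `[0, 1]`, whose derivative
`(Df(y + t h e) - Df(y' + t h e))(h e)` has norm `≤ C d(y, y')^α |h| ‖e‖`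
(Gilbarg–Trudinger 2001, §17.4). [folklore] -/
theorem holderOnWith_diffQuot {f : E → F} {x₀ e : E} {R R' h : ℝ} {C α : ℝ≥0}
    (hf : DifferentiableOn ℝ f (ball x₀ R)) (hC : HolderOnWith C α (fderiv ℝ f) (ball x₀ R))
    (hhe : ‖h • e‖ ≤ R - R') :
    HolderOnWith (C * ‖e‖₊) α (fun y => h⁻¹ • (f (y + h • e) - f y)) (ball x₀ R') := by
  refine holderOnWith_of_dist_le_rpow fun y hy y' hy' => ?_
  rcases eq_or_ne h 0 with rfl | hh
  · simp only [inv_zero, zero_smul, dist_self]; positivity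
  have hd : ∀ z ∈ ball x₀ R, DifferentiableAt ℝ f z := fun z hz =>
    hf.differentiableAt (isOpen_ball.mem_nhds hz)
  -- the auxiliary function of `t` and its derivative
  set φ : ℝ → F := fun t => f (y + t • (h • e)) - f (y' + t • (h • e)) with hφ
  set φ' : ℝ → F := fun t =>
    fderiv ℝ f (y + t • (h • e)) (h • e) - fderiv ℝ f (y' + t • (h • e)) (h • e) with hφ'
  have hderiv : ∀ t ∈ Icc (0 : ℝ) 1, HasDerivWithinAt φ (φ' t) (Icc 0 1) t := by
    intro t ht
    have h1 : ∀ w ∈ ball x₀ R', HasDerivAt (fun t : ℝ => f (w + t • (h • e)))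
        (fderiv ℝ f (w + t • (h • e)) (h • e)) t := fun w hw => by
      have hl : HasDerivAt (fun t : ℝ => w + t • (h • e)) (h • e) t := by
        simpa using ((hasDerivAt_id t).smul_const (h • e)).const_add w
      exact (hd _ (add_smul_mem_ball_of_norm_le hw hhe ht)).hasFDerivAt.comp_hasDerivAt t hl
    exact ((h1 y hy).sub (h1 y' hy')).hasDerivWithinAt
  have hbound : ∀ t ∈ Ico (0 : ℝ) 1, ‖φ' t‖ ≤ C * dist y y' ^ (α : ℝ) * ‖h • e‖ := by
    intro t ht
    have ht' : t ∈ Icc (0 : ℝ) 1 := Ico_subset_Icc_self ht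
    have hdist := hC.dist_le (add_smul_mem_ball_of_norm_le hy hhe ht')
      (add_smul_mem_ball_of_norm_le hy' hhe ht')
    rw [dist_add_right, dist_eq_norm] at hdist
    calc ‖φ' t‖ = ‖(fderiv ℝ f (y + t • (h • e)) - fderiv ℝ f (y' + t • (h • e))) (h • e)‖ := by
          simp only [hφ', sub_apply]
      _ ≤ ‖fderiv ℝ f (y + t • (h • e)) - fderiv ℝ f (y' + t • (h • e))‖ * ‖h • e‖ :=
          ContinuousLinearMap.le_opNorm _ _
      _ ≤ C * dist y y' ^ (α : ℝ) * ‖h • e‖ := by gcongr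
  have hmvt := norm_image_sub_le_of_norm_deriv_le_segment_01' hderiv hbound
  have h10 : φ 1 - φ 0 = (f (y + h • e) - f y) - (f (y' + h • e) - f y') := by
    simp only [hφ, one_smul, zero_smul, add_zero]; abel
  rw [h10] at hmvt
  rw [dist_eq_norm, ← smul_sub, norm_smul, norm_inv]
  rw [norm_smul] at hmvt
  have hh' : ‖h‖ ≠ 0 := norm_ne_zero_iff.2 hh
  calc ‖h‖⁻¹ * ‖f (y + h • e) - f y - (f (y' + h • e) - f y')‖
        ≤ ‖h‖⁻¹ * (C * dist y y' ^ (α : ℝ) * (‖h‖ * ‖e‖)) := by gcongr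
    _ = C * ‖e‖ * dist y y' ^ (α : ℝ) := by field_simp
    _ = ↑(C * ‖e‖₊) * dist y y' ^ (α : ℝ) := by push_cast; ring

/-- **Difference quotients converge to the directional derivative**: if `f` has derivative `f'`
at `y` and `hₙ → 0` with `hₙ ≠ 0`, then `Δ_{hₙ}ᵉ f (y) → f' e`. [folklore] -/
theorem tendsto_diffQuot {f : E → F} {f' : E →L[ℝ] F} {y : E} (hf : HasFDerivAt f f' y) (e : E)
    {h : ℕ → ℝ} (hh : Tendsto h atTop (𝓝[≠] 0)) :
    Tendsto (fun n => (h n)⁻¹ • (f (y + h n • e) - f y)) atTop (𝓝 (f' e)) := by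
  have hc : Tendsto (fun n => ‖(h n)⁻¹‖) atTop atTop :=
    tendsto_norm_inv_nhdsNE_zero_atTop.comp hh
  simpa only [inv_inv] using hf.lim e hc

/-- The sequence `hₙ = (n + N + 1)⁻¹` tends to `0` within `{0}ᶜ` (indeed within `(0, ∞)`), and
`0 < hₙ ≤ (N + 1)⁻¹`. [folklore] -/
theorem tendsto_inv_nat_add_nhdsNE (N : ℕ) :
    Tendsto (fun n : ℕ => ((n : ℝ) + N + 1)⁻¹) atTop (𝓝[≠] 0) ∧
      ∀ n : ℕ, 0 < ((n : ℝ) + N + 1)⁻¹ ∧ ((n : ℝ) + N + 1)⁻¹ ≤ ((N : ℝ) + 1)⁻¹ := by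
  refine ⟨?_, fun n => ⟨by positivity, ?_⟩⟩
  · have h1 : Tendsto (fun n : ℕ => ((n : ℝ) + N + 1)⁻¹) atTop (𝓝 0) := by
      have h : Tendsto (fun n : ℕ => (n : ℝ) + N + 1) atTop atTop :=
        tendsto_atTop_add_const_right _ _ (tendsto_atTop_add_const_right _ _
          tendsto_natCast_atTop_atTop)
      exact h.inv_tendsto_atTop
    refine tendsto_nhdsWithin_iff.2 ⟨h1, Eventually.of_forall fun n => ?_⟩
    exact (inv_pos.2 (by positivity)).ne'
  · exact inv_anti₀ (by positivity) (by linarith [n.cast_nonneg (α := ℝ)])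

end DiffQuot

end Literature.Analysis.Calculus
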